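import Literature.Topology.FourManifolds.CoupleSaddles

/-!
# Level transports between the flows of a couple of basin settings

Topic `Literature/Topology/FourManifolds` (fifth file of the *structure conjugacy* of two
one-level Morse data on a handlebody, support of `stmt-SmoothPoincare4-15190`; the two-function
analogue of `PairLevelTransport.lean`).  Everything here is **proved**; the one new structure is
bookkeeping.

For a couple `C : BasinCouple g_A g_B ξ_A ξ_B` and a map of levels `lam`, **reference data**
`R : C.RefData lam` consist of a reference level `ℓ₀` of `A`, an open `U` cutting a piece out of
that level, an open set `I₀ ∋ ℓ₀` of served levels on which `lam` is smooth with values in the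
open slab of `B`, and a reference map `Φ` sending the piece into the level `lam ℓ₀` of `g_B`, to
non-critical points, smoothly, such that the `ξ_B`-trajectories of the images meet the levels
`lam ℓ`, `ℓ ∈ I₀`.  The **level transport**

* `RefData.LT R x = levelProj θ_B g_B (lam (g_A x)) (Φ (levelProj θ_A g_A ℓ₀ x))`

on the open set `RefData.dom R` has level `lam ∘ g_A` (`apply_LT`), is smooth
(`contMDiffOn_LT`), is equivariant along the trajectories (`LT_levelProj`), two reference data
agree wherever their reference images lie on a common `ξ_B`-trajectory (`LT_eq_LT_of_exists_θ`),
and reference data of the swapped couple for an inverse level map inverting `Φ` invert `LT`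
(`LT_LT_of_inverse`).  The cone map of `BasinConeMap.lean`, the exit transports and the model
conjugations of the structure conjugacy are all compared in this form.

## References

* J. Milnor, *Lectures on the h-cobordism theorem* (1965), Thm. 4.1 (PDF p. 22), proof of
  Thm. 5.4, Assertion 4 (PDF p. 29). [MilnorHCobordism1965]
-/

open scoped Manifold ContDiff Topology
open Set Function Filter Metric

noncomputable section

namespace Literature.Topology.FourManifolds

open Cobordism FourManifolds.Flow

universe u

variable {n : ℕ} {W : Type u} [TopologicalSpace W] [T2Space W] [SecondCountableTopology W]
  [CompactSpace W] [ChartedSpace (EuclideanHalfSpace (n + 1)) W] [IsManifold (𝓡∂ (n + 1)) ∞ W]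

namespace BasinCouple

variable {gA gB : W → ℝ} {ξA ξB : Π x : W, TangentSpace (𝓡∂ (n + 1)) x} (C : BasinCouple gA gB ξA ξB)

/-- **Reference data for a level transport** from `(g_A, ξ_A)` to `(g_B, ξ_B)` along the level
map `lam`. [cite: MilnorHCobordism1965, Thm. 4.1 (PDF p. 22)] -/
structure RefData (lam : ℝ → ℝ) where
  /-- the reference level (of `g_A`) -/
  ℓ₀ : ℝ
  /-- the open set cutting out the reference piece of the level -/
  U : Set W
  /-- `U` is open -/
  isOpen_U : IsOpen U
  /-- the served levels (of `g_A`) -/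
  I₀ : Set ℝ
  /-- the served levels form an open set -/
  isOpen_I₀ : IsOpen I₀
  /-- the reference level is served -/
  ℓ₀_mem : ℓ₀ ∈ I₀
  /-- the served levels lie above the minimum and below `hi` -/
  I₀_subset : I₀ ⊆ Ioo (gA C.A.p₀) C.A.hi
  /-- the level map sends the served levels into the open slab of `B` -/
  lam_mem : ∀ ℓ ∈ I₀, lam ℓ ∈ Ioo C.B.lo C.B.hi
  /-- the level map is smooth at the served levels -/
  contDiffAt_lam : ∀ ℓ ∈ I₀, ContDiffAt ℝ ∞ lam ℓ
  /-- the reference map -/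
  Φ : W → W
  /-- `Φ` sends the reference piece to the level `lam ℓ₀` -/
  apply_Φ : ∀ w ∈ U, gA w = ℓ₀ → gB (Φ w) = lam ℓ₀
  /-- the `ξ_B`-trajectories of the images meet the levels `lam ℓ`, `ℓ` served -/
  hits_Φ : ∀ w ∈ U, gA w = ℓ₀ → ∀ ℓ ∈ I₀, Hits C.B.θ gB (lam ℓ) (Φ w)
  /-- the images are non-critical -/
  reg_Φ : ∀ w ∈ U, gA w = ℓ₀ → ¬ IsMCriticalPt (𝓡∂ (n + 1)) gB (Φ w)
  /-- `Φ` is smooth at the reference piece -/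
  contMDiffAt_Φ : ∀ w ∈ U, gA w = ℓ₀ → ContMDiffAt (𝓡∂ (n + 1)) (𝓡∂ (n + 1)) ∞ Φ w

namespace RefData

variable {C} {lam : ℝ → ℝ} (R : C.RefData lam)

/-- The reference level lies in `(g_A p₀, hi)`. [folklore] -/
theorem ℓ₀_mem_Ioo : R.ℓ₀ ∈ Ioo (gA C.A.p₀) C.A.hi := R.I₀_subset R.ℓ₀_mem

/-- The reference level lies in the open slab of `A`. [folklore] -/
theorem ℓ₀_mem_Ioo_A : R.ℓ₀ ∈ Ioo C.A.lo C.A.hi := C.A.Ioo_subset_Ioo_lo R.ℓ₀_mem_Ioo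

/-- The image level lies in the open slab of `B`. [folklore] -/
theorem lam_ℓ₀_mem_Ioo_B : lam R.ℓ₀ ∈ Ioo C.B.lo C.B.hi := R.lam_mem _ R.ℓ₀_mem

/-- Served levels lie in the open slab of `A`. [folklore] -/
theorem mem_Ioo_A {ℓ : ℝ} (h : ℓ ∈ R.I₀) : ℓ ∈ Ioo C.A.lo C.A.hi := C.A.Ioo_subset_Ioo_lo (R.I₀_subset h)

/-- **The domain of the level transport**: served level, non-critical, the `ξ_A`-trajectory
meets the reference level inside `U`. [cite: MilnorHCobordism1965, Thm. 4.1 (PDF p. 22)] -/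
def dom : Set W :=
  {x | gA x ∈ R.I₀ ∧ ¬ IsMCriticalPt (𝓡∂ (n + 1)) gA x ∧ Hits C.A.θ gA R.ℓ₀ x ∧ levelProj C.A.θ gA R.ℓ₀ x ∈ R.U}

/-- Membership in the domain. [folklore] -/
theorem mem_dom_iff (x : W) : x ∈ R.dom ↔
    gA x ∈ R.I₀ ∧ ¬ IsMCriticalPt (𝓡∂ (n + 1)) gA x ∧ Hits C.A.θ gA R.ℓ₀ x ∧ levelProj C.A.θ gA R.ℓ₀ x ∈ R.U :=
  Iff.rfl

/-- **The reference point** of `x`: the point of its `ξ_A`-trajectory on the reference level. [cite: MilnorHCobordism1965, Thm. 4.1 (PDF p. 22)] -/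
def ref (x : W) : W := levelProj C.A.θ gA R.ℓ₀ x

/-- `ref`, unfolded. [folklore] -/
theorem ref_def (x : W) : R.ref x = levelProj C.A.θ gA R.ℓ₀ x := rfl

/-- **The level transport**: the point of level `lam (g_A x)` on the `ξ_B`-trajectory of `Φ` of the
reference point. [cite: MilnorHCobordism1965, Thm. 4.1 (PDF p. 22)] -/
def LT (x : W) : W := levelProj C.B.θ gB (lam (gA x)) (R.Φ (R.ref x))

/-- `LT`, unfolded. [folklore] -/
theorem LT_def (x : W) : R.LT x = levelProj C.B.θ gB (lam (gA x)) (R.Φ (R.ref x)) := rfl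

variable {R} {x : W}

/-- The reference point lies on the reference level. [folklore] -/
theorem apply_ref (hx : x ∈ R.dom) : gA (R.ref x) = R.ℓ₀ := apply_hittingTime hx.2.2.1

/-- The reference point is non-critical. [folklore] -/
theorem not_isMCriticalPt_ref (hx : x ∈ R.dom) : ¬ IsMCriticalPt (𝓡∂ (n + 1)) gA (R.ref x) :=
  C.A.not_isMCriticalPt_levelProj hx.2.1 _

/-- `Φ (ref x)` lies on the image level. [folklore] -/
theorem apply_Φ_ref (hx : x ∈ R.dom) : gB (R.Φ (R.ref x)) = lam R.ℓ₀ := R.apply_Φ _ hx.2.2.2 (apply_ref hx)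

/-- `Φ (ref x)` is non-critical. [folklore] -/
theorem not_isMCriticalPt_Φ_ref (hx : x ∈ R.dom) : ¬ IsMCriticalPt (𝓡∂ (n + 1)) gB (R.Φ (R.ref x)) :=
  R.reg_Φ _ hx.2.2.2 (apply_ref hx)

/-- The `ξ_B`-trajectory of `Φ (ref x)` meets every level `lam ℓ`, `ℓ` served. [folklore] -/
theorem hits_Φ_ref (hx : x ∈ R.dom) {ℓ : ℝ} (hℓ : ℓ ∈ R.I₀) : Hits C.B.θ gB (lam ℓ) (R.Φ (R.ref x)) :=
  R.hits_Φ _ hx.2.2.2 (apply_ref hx) ℓ hℓ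

/-- **The level transport has level `lam ∘ g_A`.** [cite: MilnorHCobordism1965, Thm. 4.1 (PDF p. 22)] -/
theorem apply_LT (hx : x ∈ R.dom) : gB (R.LT x) = lam (gA x) := apply_hittingTime (hits_Φ_ref hx hx.1)

/-- The level transport lands at non-critical points. [folklore] -/
theorem not_isMCriticalPt_LT (hx : x ∈ R.dom) : ¬ IsMCriticalPt (𝓡∂ (n + 1)) gB (R.LT x) :=
  C.B.not_isMCriticalPt_levelProj (not_isMCriticalPt_Φ_ref hx) _

/-- The transported point meets every level `lam ℓ`, `ℓ` served. [folklore] -/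
theorem hits_LT (hx : x ∈ R.dom) {ℓ : ℝ} (hℓ : ℓ ∈ R.I₀) : Hits C.B.θ gB (lam ℓ) (R.LT x) := by
  rw [LT_def, C.B.hits_levelProj_iff]; exact hits_Φ_ref hx hℓ

/-- **The level point at the image level of the transported point is `Φ (ref x)`.** [folklore] -/
theorem levelProj_LT_ℓ₀ (hx : x ∈ R.dom) : levelProj C.B.θ gB (lam R.ℓ₀) (R.LT x) = R.Φ (R.ref x) := by
  rw [LT_def, C.B.levelProj_levelProj (not_isMCriticalPt_Φ_ref hx) _ (Ioo_subset_Icc_self R.lam_ℓ₀_mem_Ioo_B)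
    (hits_of_apply_eq (C.B.θ_zero _) (apply_Φ_ref hx)),
    C.B.levelProj_eq_self (not_isMCriticalPt_Φ_ref hx) (Ioo_subset_Icc_self R.lam_ℓ₀_mem_Ioo_B) (apply_Φ_ref hx)]

/-- Level points of the transported point at image levels. [folklore] -/
theorem levelProj_LT (hx : x ∈ R.dom) {ℓ : ℝ} (hℓ : ℓ ∈ R.I₀) :
    levelProj C.B.θ gB (lam ℓ) (R.LT x) = levelProj C.B.θ gB (lam ℓ) (R.Φ (R.ref x)) :=
  C.B.levelProj_levelProj (not_isMCriticalPt_Φ_ref hx) _ (Ioo_subset_Icc_self (R.lam_mem _ hℓ)) (hits_Φ_ref hx hℓ)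

/-! #### Openness and invariance of the domain -/

/-- **The domain is a neighbourhood of each of its points** (it is open). [cite: MilnorHCobordism1965, proof of Thm. 5.4, Assertion 4 (PDF p. 29)] -/
theorem dom_mem_nhds (hx : x ∈ R.dom) : R.dom ∈ 𝓝 x := by
  have hgc : Continuous gA := C.A.isMorseFunction.isMorse.contMDiff.continuous
  have hslab : gA x ∈ Icc C.A.lo C.A.hi := Ioo_subset_Icc_self (R.mem_Ioo_A hx.1)
  have h1 : {z : W | gA z ∈ R.I₀} ∈ 𝓝 x := hgc.continuousAt.preimage_mem_nhds (R.isOpen_I₀.mem_nhds hx.1)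
  have h2 : {z : W | ¬ IsMCriticalPt (𝓡∂ (n + 1)) gA z} ∈ 𝓝 x :=
    C.A.slabFlow'.isOpen_setOf_not_isMCriticalPt.mem_nhds hx.2.1
  have h3 : {z : W | Hits C.A.θ gA R.ℓ₀ z} ∈ 𝓝 x := C.A.hits_mem_nhds' hslab hx.2.1 R.ℓ₀_mem_Ioo_A hx.2.2.1
  have h4 : {z : W | levelProj C.A.θ gA R.ℓ₀ z ∈ R.U} ∈ 𝓝 x :=
    (C.A.contMDiffAt_levelProj hslab hx.2.1 R.ℓ₀_mem_Ioo_A hx.2.2.1).continuousAt.preimage_mem_nhds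
      (R.isOpen_U.mem_nhds hx.2.2.2)
  filter_upwards [h1, h2, h3, h4] with z hz1 hz2 hz3 hz4
  exact ⟨hz1, hz2, hz3, hz4⟩

/-- The reference point is constant along `ξ_A`-trajectories. [folklore] -/
theorem ref_θ (hx : x ∈ R.dom) (t : ℝ) : R.ref (C.A.θ (t, x)) = R.ref x :=
  C.A.levelProj_θ hx.2.1 (Ioo_subset_Icc_self R.ℓ₀_mem_Ioo_A) hx.2.2.1 t

/-- **Points of the `ξ_A`-trajectory at served levels stay in the domain.** [folklore] -/
theorem θ_mem_dom (hx : x ∈ R.dom) {t : ℝ} (ht : gA (C.A.θ (t, x)) ∈ R.I₀) : C.A.θ (t, x) ∈ R.dom := by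
  refine ⟨ht, (C.A.isMCriticalPt_θ_iff t x).not.2 hx.2.1, (C.A.hits_θ_iff t x _).2 hx.2.2.1, ?_⟩
  have h := ref_θ hx t
  rw [ref_def, ref_def] at h
  rw [h]; exact hx.2.2.2

/-- Level points of domain points at served levels stay in the domain. [folklore] -/
theorem levelProj_mem_dom (hx : x ∈ R.dom) {ℓ : ℝ} (hℓ : ℓ ∈ R.I₀) (hh : Hits C.A.θ gA ℓ x) :
    levelProj C.A.θ gA ℓ x ∈ R.dom := by
  have h := θ_mem_dom hx (t := hittingTime C.A.θ gA ℓ x) (by rw [apply_hittingTime hh]; exact hℓ)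
  exact h

/-- **Equivariance along the trajectories**: the transport of the level point of `x` at a served
level `ℓ` is the level point at `lam ℓ` of the transport of `x`. [cite: MilnorHCobordism1965, Thm. 4.1 (PDF p. 22)] -/
theorem LT_levelProj (hx : x ∈ R.dom) {ℓ : ℝ} (hℓ : ℓ ∈ R.I₀) (hh : Hits C.A.θ gA ℓ x) :
    R.LT (levelProj C.A.θ gA ℓ x) = levelProj C.B.θ gB (lam ℓ) (R.LT x) := by
  have h1 : R.ref (levelProj C.A.θ gA ℓ x) = R.ref x := by rw [levelProj_apply]; exact ref_θ hx _
  rw [LT_def, h1, show gA (levelProj C.A.θ gA ℓ x) = ℓ from apply_hittingTime hh, levelProj_LT hx hℓ]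

/-- The transport along a `ξ_A`-trajectory, in terms of the common reference point. [folklore] -/
theorem LT_θ (hx : x ∈ R.dom) (t : ℝ) :
    R.LT (C.A.θ (t, x)) = levelProj C.B.θ gB (lam (gA (C.A.θ (t, x)))) (R.Φ (R.ref x)) := by
  rw [LT_def, ref_θ hx]

/-! #### Smoothness -/

variable (R) in
/-- **The level transport is smooth on its domain** (stated on the domain; the domain is a
neighbourhood of each of its points, `dom_mem_nhds`). [cite: MilnorHCobordism1965, Thm. 4.1, proof of Thm. 5.4 Assertion 4 (PDF pp. 22, 29)] -/
theorem contMDiffOn_LT : ContMDiffOn (𝓡∂ (n + 1)) (𝓡∂ (n + 1)) ∞ R.LT R.dom := by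
  intro x hx
  refine ContMDiffAt.contMDiffWithinAt ?_
  have href : ContMDiffAt (𝓡∂ (n + 1)) (𝓡∂ (n + 1)) ∞ R.ref x :=
    C.A.contMDiffAt_levelProj (Ioo_subset_Icc_self (R.mem_Ioo_A hx.1)) hx.2.1 R.ℓ₀_mem_Ioo_A hx.2.2.1
  set w₁ : W := R.Φ (R.ref x) with hw₁
  have hout : ContMDiffAt ((𝓡∂ (n + 1)).prod 𝓘(ℝ, ℝ)) (𝓡∂ (n + 1)) ∞
      (fun p : W × ℝ => levelProj C.B.θ gB p.2 p.1) (w₁, lam (gA x)) :=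
    C.B.contMDiffAt_levelProj_prod (by rw [apply_Φ_ref hx]; exact Ioo_subset_Icc_self R.lam_ℓ₀_mem_Ioo_B)
      (not_isMCriticalPt_Φ_ref hx) (R.lam_mem _ hx.1) (hits_Φ_ref hx hx.1)
  have hlam : ContMDiffAt (𝓡∂ (n + 1)) 𝓘(ℝ, ℝ) ∞ (fun z : W => lam (gA z)) x :=
    (R.contDiffAt_lam _ hx.1).contMDiffAt.comp x C.A.isMorseFunction.isMorse.contMDiff.contMDiffAt
  have hin : ContMDiffAt (𝓡∂ (n + 1)) ((𝓡∂ (n + 1)).prod 𝓘(ℝ, ℝ)) ∞ (fun z : W => (R.Φ (R.ref z), lam (gA z))) x := by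
    refine ContMDiffAt.prodMk ?_ hlam
    exact (R.contMDiffAt_Φ (R.ref x) hx.2.2.2 (apply_ref hx)).comp x href
  have key : ContMDiffAt (𝓡∂ (n + 1)) (𝓡∂ (n + 1)) ∞
      ((fun p : W × ℝ => levelProj C.B.θ gB p.2 p.1) ∘ fun z : W => (R.Φ (R.ref z), lam (gA z))) x :=
    hout.comp x hin
  exact key

/-! #### Comparing two level transports -/

/-- **A level transport is determined by the `ξ_B`-trajectory of its reference image**: if `y`
lies on the `ξ_B`-trajectory of `Φ (ref x)` and has level `lam (g_A x)`, then `LT x = y`. [cite: MilnorHCobordism1965, Thm. 4.1 (PDF p. 22)] -/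
theorem LT_eq_of_exists_θ (hx : x ∈ R.dom) {y : W} (hy : ∃ t, C.B.θ (t, R.Φ (R.ref x)) = y)
    (hgy : gB y = lam (gA x)) : R.LT x = y := by
  obtain ⟨t, rfl⟩ := hy
  exact C.B.levelProj_eq_θ_of_apply_eq (not_isMCriticalPt_Φ_ref hx) (Ioo_subset_Icc_self (R.lam_mem _ hx.1)) hgy

/-- **Two reference data (same level map) give the same transport at a common point of their
domains as soon as their reference images lie on a common `ξ_B`-trajectory.** [cite: MilnorHCobordism1965, Thm. 4.1 (PDF p. 22)] -/
theorem LT_eq_LT_of_exists_θ {R₁ R₂ : C.RefData lam} (hx₁ : x ∈ R₁.dom) (hx₂ : x ∈ R₂.dom)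
    (h : ∃ t, C.B.θ (t, R₁.Φ (R₁.ref x)) = R₂.Φ (R₂.ref x)) : R₁.LT x = R₂.LT x := by
  obtain ⟨t, ht⟩ := h
  have h1 : R₂.LT x = levelProj C.B.θ gB (lam (gA x)) (C.B.θ (t, R₁.Φ (R₁.ref x))) := by rw [ht]; rfl
  rw [h1, C.B.levelProj_θ (not_isMCriticalPt_Φ_ref hx₁) (Ioo_subset_Icc_self (R₁.lam_mem _ hx₁.1))
    (hits_Φ_ref hx₁ hx₁.1)]
  have _ := hx₂
  rfl

/-- The criterion in terms of level points: the reference images agree after projecting the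
first to the image level of the second. [cite: MilnorHCobordism1965, Thm. 4.1 (PDF p. 22)] -/
theorem LT_eq_LT_of_levelProj_eq {R₁ R₂ : C.RefData lam} (hx₁ : x ∈ R₁.dom) (hx₂ : x ∈ R₂.dom)
    (h : levelProj C.B.θ gB (lam R₂.ℓ₀) (R₁.Φ (R₁.ref x)) = R₂.Φ (R₂.ref x)) : R₁.LT x = R₂.LT x :=
  LT_eq_LT_of_exists_θ hx₁ hx₂ ⟨_, h⟩

/-- A map agreeing with a level transport: if `y = F x` lies on the `ξ_B`-trajectory of the
reference image of `x` at level `lam (g_A x)` then `LT x = F x` (restated for maps). [folklore] -/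
theorem LT_eq_apply_of_exists_θ (hx : x ∈ R.dom) {F : W → W} (hy : ∃ t, C.B.θ (t, R.Φ (R.ref x)) = F x)
    (hgy : gB (F x) = lam (gA x)) : R.LT x = F x := LT_eq_of_exists_θ hx hy hgy

/-! #### Inverting a level transport by the swapped couple -/

/-- **Reference data of the swapped couple for an inverse level map, inverting `Φ`, invert the
level transport**, and the transported point lies in their domain. [cite: MilnorHCobordism1965, Thm. 4.1 (PDF p. 22)] -/
theorem LT_LT_of_inverse {lam' : ℝ → ℝ} (R' : C.swap.RefData lam') (hℓ : R'.ℓ₀ = lam R.ℓ₀)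
    (hlam' : ∀ ℓ ∈ R.I₀, lam' (lam ℓ) = ℓ)
    (hU : ∀ w ∈ R.U, gA w = R.ℓ₀ → R.Φ w ∈ R'.U) (hinv : ∀ w ∈ R.U, gA w = R.ℓ₀ → R'.Φ (R.Φ w) = w)
    (hx : x ∈ R.dom) (hI : lam (gA x) ∈ R'.I₀) : R.LT x ∈ R'.dom ∧ R'.LT (R.LT x) = x := by
  have hrefy : R'.ref (R.LT x) = R.Φ (R.ref x) := by
    rw [ref_def, swap_A, hℓ]; exact levelProj_LT_ℓ₀ hx
  have hhit : Hits C.B.θ gB R'.ℓ₀ (R.LT x) := by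
    rw [hℓ, LT_def, C.B.hits_levelProj_iff]
    exact hits_of_apply_eq (C.B.θ_zero _) (apply_Φ_ref hx)
  have hmem : R.LT x ∈ R'.dom := by
    refine ⟨by rw [apply_LT hx]; exact hI, not_isMCriticalPt_LT hx, hhit, ?_⟩
    have h := hrefy; rw [ref_def] at h
    show levelProj C.swap.A.θ gB R'.ℓ₀ (R.LT x) ∈ R'.U
    rw [h]
    exact hU _ hx.2.2.2 (apply_ref hx)
  refine ⟨hmem, ?_⟩
  rw [LT_def, hrefy, hinv (R.ref x) hx.2.2.2 (apply_ref hx), apply_LT hx, hlam' _ hx.1, swap_B, ref_def]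
  have h1 : levelProj C.A.θ gA (gA x) (levelProj C.A.θ gA R.ℓ₀ x) = levelProj C.A.θ gA (gA x) x :=
    C.A.levelProj_levelProj hx.2.1 _ (Ioo_subset_Icc_self (R.mem_Ioo_A hx.1)) (hits_of_apply_eq (C.A.θ_zero x) rfl)
  rw [h1]
  exact C.A.levelProj_eq_self hx.2.1 (Ioo_subset_Icc_self (R.mem_Ioo_A hx.1)) rfl

end RefData

/-! ### The cone map is a level transport -/

section Cone

variable {C} {lam : ℝ → ℝ} {T : EuclideanSpace ℝ (Fin (n + 1)) → EuclideanSpace ℝ (Fin (n + 1))}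

/-- **Reference data of the cone map**: reference level `sphR_A` (the small sphere of `A`),
reference piece cut out by an open set `U` of the sphere region, served levels `I₀`, reference map
`ofChart_B ∘ T ∘ toChart_A`; the hypotheses say that `T` is smooth and maps the chart vectors of
the piece to non-zero vectors of norm `< r₀` whose `B`-rays meet the levels `lam ℓ`, `ℓ ∈ I₀`. [cite: MilnorHCobordism1965, Def. 3.9, Thm. 4.1] -/
def refCone (U : Set W) (hU : IsOpen U) (I₀ : Set ℝ) (hI₀ : IsOpen I₀) (hsph : C.A.sphR ∈ I₀)
    (hI₀s : I₀ ⊆ Ioo (gA C.A.p₀) C.A.hi) (hlam : ∀ ℓ ∈ I₀, lam ℓ ∈ Ioo C.B.lo C.B.hi)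
    (hlams : ∀ ℓ ∈ I₀, ContDiffAt ℝ ∞ lam ℓ) (hsphR : lam C.A.sphR = C.B.sphR)
    (hTs : ∀ w ∈ U, gA w = C.A.sphR → ContDiffAt ℝ ∞ T (C.A.toChart w))
    (hTn : ∀ w ∈ U, gA w = C.A.sphR → ‖T (C.A.toChart w)‖ = C.B.rad)
    (hTh : ∀ w ∈ U, gA w = C.A.sphR → ∀ ℓ ∈ I₀, Hits C.B.θ gB (lam ℓ) (C.B.ofChart (T (C.A.toChart w)))) :
    C.RefData lam where
  ℓ₀ := C.A.sphR
  U := U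
  isOpen_U := hU
  I₀ := I₀
  isOpen_I₀ := hI₀
  ℓ₀_mem := hsph
  I₀_subset := hI₀s
  lam_mem := hlam
  contDiffAt_lam := hlams
  Φ w := C.B.ofChart (T (C.A.toChart w))
  apply_Φ w hw hwℓ := by rw [hsphR]; exact (C.B.apply_ofChart_eq_sphR_iff (C.B.norm_lt_r₀_of_eq_rad (hTn w hw hwℓ)).le).2 (hTn w hw hwℓ)
  hits_Φ := hTh
  reg_Φ w hw hwℓ := C.B.not_isMCriticalPt_ofChart (hTn w hw hwℓ)
  contMDiffAt_Φ w hw hwℓ := by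
    have h1 : ContMDiffAt (𝓡∂ (n + 1)) 𝓘(ℝ, EuclideanSpace ℝ (Fin (n + 1))) ∞ (fun w => T (C.A.toChart w)) w :=
      (hTs w hw hwℓ).contMDiffAt.comp w (C.A.contMDiffAt_toChart (C.A.mem_source_of_apply_le (by rw [hwℓ]; exact C.A.sphR_le_sph)))
    have h2 := (C.B.contMDiffAt_ofChart (C.B.norm_lt_r₀_of_eq_rad (hTn w hw hwℓ))).comp w h1
    exact h2

/-- **The cone map is the level transport of its reference data** (definitionally). [folklore] -/
theorem coneMap_eq_LT_refCone {U : Set W} (hU : IsOpen U) {I₀ : Set ℝ} (hI₀ : IsOpen I₀) (hsph : C.A.sphR ∈ I₀)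
    (hI₀s : I₀ ⊆ Ioo (gA C.A.p₀) C.A.hi) (hlam : ∀ ℓ ∈ I₀, lam ℓ ∈ Ioo C.B.lo C.B.hi)
    (hlams : ∀ ℓ ∈ I₀, ContDiffAt ℝ ∞ lam ℓ) (hsphR : lam C.A.sphR = C.B.sphR)
    (hTs : ∀ w ∈ U, gA w = C.A.sphR → ContDiffAt ℝ ∞ T (C.A.toChart w))
    (hTn : ∀ w ∈ U, gA w = C.A.sphR → ‖T (C.A.toChart w)‖ = C.B.rad)
    (hTh : ∀ w ∈ U, gA w = C.A.sphR → ∀ ℓ ∈ I₀, Hits C.B.θ gB (lam ℓ) (C.B.ofChart (T (C.A.toChart w)))) (x : W) :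
    C.A.coneMap C.B T lam x = (refCone U hU I₀ hI₀ hsph hI₀s hlam hlams hsphR hTs hTn hTh).LT x := rfl

end Cone

end BasinCouple

end Literature.Topology.FourManifolds
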